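import Summits.QuantumFields.BalabanUV.Beta.GAN24.HardMinimiserRateTransfer

/-!
# `BalabanUV.Beta.GAN24.BlockRatesFromSoftResolvent` — binder row G-an2-4 ∕ (CONV-C), route R6 «VALUES, NOT DERIVATIVES», PART 113:
# «ONE SOFT LETTER» — the two RATE letters of PARTs 107 ∕ 112 (the block propagator's one-step increment `P − P′` and the soft columns' averaged
# one-step mismatch `Qf·K′⁻¹Q′ᵀ − K⁻¹Qᵀ`) ARE the sandwiched one-step law of the soft resolvent `E = Qf·K′⁻¹·Qfᵀ − K⁻¹` seen through the block
# locality of `Q`, once the unit averagings compose (`Q′ = Q·Qf`); hence Σ's and Ξ's RATE from `E` alone (unit b2b-balaban-gan24-p3, gen 50; v1)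

NOT IN PRINT; OUR PROOF (for the ROUTE; [folklore] — two lines of matrix algebra (`P − P′ = −Q·E·Qᵀ`, `Qf·K′⁻¹Q′ᵀ − K⁻¹Qᵀ = E·Qᵀ` when `Q′ = Q·Qf`), the
row-mass ∕ support transfer of PART 105 §4 for a GENERAL kernel, and PARTs 107 `abs_effForm_sub_effForm_le` ∕ 112 `abs_avg_minOp_sub_le` BY NAME).
HONEST FRAMING (cell contract, verbatim): «discharging `BetaPertH` makes Bałaban's UV stability UNCONDITIONAL — a real constructive-QFT result; it is NOT the continuum limit and NOT
the Clay problem.»  HONEST DEPENDENCY (verbatim): «continuum YM on T⁴ ⇐ BetaPertH ∧ nine spine estimates (0/9 proved); BetaPertH ⇐ (D1) ∧ (D4) ∧ CAP+tail; G-an2-4 gates asym, D1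
and NE2/3/4.»

WHY THIS FILE.  PARTs 105–107 and 112 reduced BOTH (CONV-C)-shape clauses of the Σ-block (`𝒮 = effForm`) and the Ξ-block (`ℋ = minOp`) of the bordered inverse to four
letters: the DECAY of `P = QK⁻¹Qᵀ` and of `K⁻¹Qᵀ` (PART 105 §4: both from the fine decay of the soft resolvent `K⁻¹` + the block locality of `Q`) and two RATE letters —
`|P − P′| ≤ ε₂e^{−δ₀ρ}` (PART 107) and `|Qf·K′⁻¹Q′ᵀ − K⁻¹Qᵀ| ≤ ε₁e^{−δ₁σ}` (PART 112).  In the tower the unit averaging of level `k+1` is the unit averaging of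
level `k` after the one-step block averaging, `Q′ = Q·Qf`; then BOTH rate letters are images of ONE fine-lattice kernel, the sandwiched one-step increment of the
soft resolvent `E := Qf·K′⁻¹·Qfᵀ − K⁻¹` (Bałaban's «`G_{k+1}` averaged once is close to `G_k`», the (3.42)-type statement the row's list carries for the
`G_k`-constituent): `P − P′ = −Q·E·Qᵀ` and `Qf·K′⁻¹Q′ᵀ − K⁻¹Qᵀ = E·Qᵀ`.  So on the row's list the RATE half of (CONV-C) for Σ and Ξ costs exactly ONE one-step
law with decay — that of the soft resolvent — plus PART 105's decay letters and the upper bound; nothing of the HARD minimiser's own one-step analysis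
(PART 92's energy-currency mismatch) is needed for the kernel-currency two clauses.

WHAT THIS FILE PROVES (0 sorry, 0 `def`, nothing cited; letters of PARTs 105 ∕ 112: unit index `c` (`ρ`, `Kf`), fine index sets `ν ⊇` (coarser) and `ν′` (finer), fine
pseudo-gauge `D : ν → ν → ℝ`, fine-to-unit gauge `σ : ν → c → ℝ`, `Q : Matrix c ν ℝ`, `Qf : Matrix ν ν′ ℝ`, `K`, `K′` ANY square matrices in §1–§3):
* §1 **`blockProp_sub_blockProp_mul`** (`P_K(Q) − P_{K′}(Q·Qf) = Q·(K⁻¹ − Qf K′⁻¹Qfᵀ)·Qᵀ`), **`avg_mul_col_sub_eq`** (`Qf·(K′⁻¹(Q·Qf)ᵀ) − K⁻¹Qᵀ = (Qf K′⁻¹Qfᵀ − K⁻¹)·Qᵀ`).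
* §2 **`abs_conj_transpose_apply_le`**, **`abs_mul_transpose_apply_le`** — PART 105 §4's two transfers for a GENERAL fine kernel `G` with `|G(x,y)| ≤ Ce^{−δD(x,y)}`:
  `|(Q·G·Qᵀ)(b,b′)| ≤ q₁²Ce^{δR}e^{−δρ(b,b′)}`, `|(G·Qᵀ)(x,b)| ≤ q₁Ce^{δR′}e^{−δσ(x,b)}` (row mass `Σ_x|Q(b,x)| ≤ q₁`, support compatibilities with offsets `R, R′`).
* §3 **`abs_blockProp_sub_le_of_soft`**, **`abs_avg_col_sub_le_of_soft`** — THE TWO RATE LETTERS FROM THE ONE: `|E(x,y)| ≤ εe^{−δD(x,y)}` ⟹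
  `|(P − P′)(b,b′)| ≤ q₁²εe^{δR}e^{−δρ(b,b′)}` and `|(Qf·K′⁻¹Q′ᵀ − K⁻¹Qᵀ)(x,b)| ≤ q₁εe^{δR′}e^{−δσ(x,b)}` (`Q′ = Q·Qf`).
* §4 **`abs_effForm_sub_le_of_soft`** (Σ's RATE from `E`: PART 107's bound with `ε₂ = q₁²εe^{δR}`), **`abs_avg_minOp_sub_le_of_soft`** (Ξ's RATE from `E`: PART 112's
  bound with `ε₁ = q₁εe^{δR′}`, `ε₂ = q₁²εe^{δR}`) — both LINEAR in `ε`, for the constrained data `(H, Q)`, `(H′, Q·Qf)` under PART 105's hypotheses at both levels.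
WHAT IT DOES NOT DO: supply `E`'s law (Bałaban-class with background: [B9] (3.42)-type, not in the tree at general `U`; at `U = 1` scalar road P2 types the
prolongation-direction law `M′ − J·M` of the soft MINIMISER, `MinimiserOneStepDecayCubic`, not `E` itself); the 𝒢-block's sandwiched rate; instantiate.  SUPPLIER work on
route C-R6° (rank 2, REDUCTION); no consumer of record; NEVER «G-an2-4 closed»; NOT (CONV-C), NOT D1, NOT `BetaPertH`, NOT continuum, NOT Clay.
Records: `HOME/b2b-balaban-gan24-p3/gen50/README.md`.
-/

noncomputable section

open scoped BigOperators Matrix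
open Finset Matrix
open Literature.MathematicalPhysics.QuantumFieldTheory.Balaban1983to89
open Literature.MathematicalPhysics.QuantumFieldTheory.Balaban1983to89.B4Sect5Torus (IsPseudoDist SumBound rate rate_pos rate_le_delta0)
open Literature.MathematicalPhysics.QuantumFieldTheory.Balaban1983to89.Beta.Composition (blockProp)
open Literature.MathematicalPhysics.QuantumFieldTheory.Balaban1983to89.Beta.CompositionSingular (effForm minOp)
open Summit.QuantumFields.BalabanUV.Beta.GAN24.EffectiveFormRateTransfer (abs_effForm_sub_effForm_le)
open Summit.QuantumFields.BalabanUV.Beta.GAN24.HardMinimiserRateTransfer (abs_avg_minOp_sub_le)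

namespace Summit.QuantumFields.BalabanUV.Beta.GAN24.BlockRatesFromSoftResolvent

variable {c ν ν' : Type*} [Fintype c] [Fintype ν] [Fintype ν'] [DecidableEq c] [DecidableEq ν] [DecidableEq ν']

/-! ## §1 Two lines of algebra under `Q′ = Q·Qf` -/

omit [Fintype c] [DecidableEq c] in
/-- **`blockProp_sub_blockProp_mul`** [our proof]: `Q·K⁻¹·Qᵀ − (Q·Qf)·K′⁻¹·(Q·Qf)ᵀ = Q·(K⁻¹ − Qf·K′⁻¹·Qfᵀ)·Qᵀ`. -/
theorem blockProp_sub_blockProp_mul (K : Matrix ν ν ℝ) (K' : Matrix ν' ν' ℝ) (Q : Matrix c ν ℝ) (Qf : Matrix ν ν' ℝ) :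
    blockProp K Q - blockProp K' (Q * Qf) = Q * (K⁻¹ - Qf * K'⁻¹ * Qfᵀ) * Qᵀ := by
  simp only [blockProp, Matrix.transpose_mul, Matrix.mul_sub, Matrix.sub_mul, Matrix.mul_assoc]

omit [Fintype c] [DecidableEq c] in
/-- **`avg_mul_col_sub_eq`** [our proof]: `Qf·(K′⁻¹·(Q·Qf)ᵀ) − K⁻¹·Qᵀ = (Qf·K′⁻¹·Qfᵀ − K⁻¹)·Qᵀ`. -/
theorem avg_mul_col_sub_eq (K : Matrix ν ν ℝ) (K' : Matrix ν' ν' ℝ) (Q : Matrix c ν ℝ) (Qf : Matrix ν ν' ℝ) :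
    Qf * (K'⁻¹ * (Q * Qf)ᵀ) - K⁻¹ * Qᵀ = (Qf * K'⁻¹ * Qfᵀ - K⁻¹) * Qᵀ := by
  simp only [Matrix.transpose_mul, Matrix.sub_mul, Matrix.mul_assoc]

/-! ## §2 PART 105 §4's two transfers for a general fine kernel -/

section Transfer

variable {Q : Matrix c ν ℝ} {ρ : c → c → ℝ} {σ : ν → c → ℝ} {D : ν → ν → ℝ}

omit [Fintype c] [DecidableEq c] [DecidableEq ν] in
/-- **`abs_conj_transpose_apply_le` — UNIT-LATTICE DECAY OF `Q·G·Qᵀ` FROM FINE DECAY OF `G`** [our proof; PART 105 `abs_blockProp_le_of_resolvent` for a general kernel]: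
`|G(x,x′)| ≤ Ce^{−δD(x,x′)}` (`C, δ ≥ 0`), `Σ_x|Q(b,x)| ≤ q₁`, `Q(b,x) ≠ 0 → Q(b′,x′) ≠ 0 → ρ(b,b′) ≤ D(x,x′) + R` ⟹ `|(Q·G·Qᵀ)(b,b′)| ≤ q₁²·C·e^{δR}·e^{−δρ(b,b′)}`. -/
theorem abs_conj_transpose_apply_le {G : Matrix ν ν ℝ} {C δ q₁ R : ℝ} (hC : 0 ≤ C) (hδ : 0 ≤ δ)
    (hG : ∀ x x', |G x x'| ≤ C * Real.exp (-(δ * D x x'))) (hq : ∀ b, ∑ x, |Q b x| ≤ q₁)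
    (hQρ : ∀ b x b' x', Q b x ≠ 0 → Q b' x' ≠ 0 → ρ b b' ≤ D x x' + R) (b b' : c) :
    |(Q * G * Qᵀ) b b'| ≤ q₁ ^ 2 * C * Real.exp (δ * R) * Real.exp (-(δ * ρ b b')) := by
  have hq0 : 0 ≤ q₁ := (Finset.sum_nonneg fun x _ => abs_nonneg (Q b x)).trans (hq b)
  have hpt : ∀ x x', |Q b x * G x x' * Q b' x'| ≤ |Q b x| * |Q b' x'| * (C * Real.exp (δ * R) * Real.exp (-(δ * ρ b b'))) := by
    intro x x'
    rw [abs_mul, abs_mul]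
    by_cases hx : Q b x = 0
    · simp [hx]
    by_cases hx' : Q b' x' = 0
    · simp [hx']
    have hcomp := hQρ b x b' x' hx hx'
    have hexp : Real.exp (-(δ * D x x')) ≤ Real.exp (δ * R) * Real.exp (-(δ * ρ b b')) := by
      rw [← Real.exp_add]; apply Real.exp_le_exp.mpr; nlinarith
    calc |Q b x| * |G x x'| * |Q b' x'| = |Q b x| * |Q b' x'| * |G x x'| := by ring
      _ ≤ |Q b x| * |Q b' x'| * (C * Real.exp (-(δ * D x x'))) := mul_le_mul_of_nonneg_left (hG x x') (by positivity)
      _ ≤ |Q b x| * |Q b' x'| * (C * (Real.exp (δ * R) * Real.exp (-(δ * ρ b b')))) :=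
          mul_le_mul_of_nonneg_left (mul_le_mul_of_nonneg_left hexp hC) (by positivity)
      _ = |Q b x| * |Q b' x'| * (C * Real.exp (δ * R) * Real.exp (-(δ * ρ b b'))) := by ring
  have happly : (Q * G * Qᵀ) b b' = ∑ x', ∑ x, Q b x * G x x' * Q b' x' := by
    rw [Matrix.mul_apply]
    refine Finset.sum_congr rfl fun x' _ => ?_
    rw [Matrix.mul_apply, transpose_apply, Finset.sum_mul]
  rw [happly, Finset.sum_comm]
  calc |∑ x, ∑ x', Q b x * G x x' * Q b' x'|
      ≤ ∑ x, |∑ x', Q b x * G x x' * Q b' x'| := Finset.abs_sum_le_sum_abs _ _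
    _ ≤ ∑ x, ∑ x', |Q b x * G x x' * Q b' x'| := Finset.sum_le_sum fun x _ => Finset.abs_sum_le_sum_abs _ _
    _ ≤ ∑ x, ∑ x', |Q b x| * |Q b' x'| * (C * Real.exp (δ * R) * Real.exp (-(δ * ρ b b'))) :=
        Finset.sum_le_sum fun x _ => Finset.sum_le_sum fun x' _ => hpt x x'
    _ = (∑ x, |Q b x|) * (∑ x', |Q b' x'|) * (C * Real.exp (δ * R) * Real.exp (-(δ * ρ b b'))) := by
        rw [Finset.sum_mul, Finset.sum_mul]
        refine Finset.sum_congr rfl fun x _ => ?_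
        rw [Finset.mul_sum, Finset.sum_mul]
    _ ≤ q₁ * q₁ * (C * Real.exp (δ * R) * Real.exp (-(δ * ρ b b'))) := by
        apply mul_le_mul_of_nonneg_right _ (by positivity)
        exact mul_le_mul (hq b) (hq b') (Finset.sum_nonneg fun x _ => abs_nonneg _) hq0
    _ = q₁ ^ 2 * C * Real.exp (δ * R) * Real.exp (-(δ * ρ b b')) := by ring

omit [Fintype c] [DecidableEq c] [DecidableEq ν] in
/-- **`abs_mul_transpose_apply_le` — FINE-TO-UNIT DECAY OF `G·Qᵀ` FROM FINE DECAY OF `G`** [our proof; PART 105 `abs_inv_mul_transpose_le_of_resolvent` for a general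
kernel]: `|G(x,x′)| ≤ Ce^{−δD(x,x′)}` (`C, δ ≥ 0`), `Σ_x|Q(b,x)| ≤ q₁`, `Q(b,x′) ≠ 0 → σ(x,b) ≤ D(x,x′) + R′` ⟹ `|(G·Qᵀ)(x,b)| ≤ q₁·C·e^{δR′}·e^{−δσ(x,b)}`. -/
theorem abs_mul_transpose_apply_le {G : Matrix ν ν ℝ} {C δ q₁ R' : ℝ} (hC : 0 ≤ C) (hδ : 0 ≤ δ)
    (hG : ∀ x x', |G x x'| ≤ C * Real.exp (-(δ * D x x'))) (hq : ∀ b, ∑ x, |Q b x| ≤ q₁)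
    (hQσ : ∀ b x x', Q b x' ≠ 0 → σ x b ≤ D x x' + R') (x : ν) (b : c) :
    |(G * Qᵀ) x b| ≤ q₁ * C * Real.exp (δ * R') * Real.exp (-(δ * σ x b)) := by
  have hpt : ∀ x', |G x x' * Q b x'| ≤ |Q b x'| * (C * Real.exp (δ * R') * Real.exp (-(δ * σ x b))) := by
    intro x'
    rw [abs_mul]
    by_cases hx' : Q b x' = 0
    · simp [hx']
    have hcomp := hQσ b x x' hx'
    have hexp : Real.exp (-(δ * D x x')) ≤ Real.exp (δ * R') * Real.exp (-(δ * σ x b)) := by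
      rw [← Real.exp_add]; apply Real.exp_le_exp.mpr; nlinarith
    calc |G x x'| * |Q b x'| = |Q b x'| * |G x x'| := mul_comm _ _
      _ ≤ |Q b x'| * (C * Real.exp (-(δ * D x x'))) := mul_le_mul_of_nonneg_left (hG x x') (abs_nonneg _)
      _ ≤ |Q b x'| * (C * (Real.exp (δ * R') * Real.exp (-(δ * σ x b)))) :=
          mul_le_mul_of_nonneg_left (mul_le_mul_of_nonneg_left hexp hC) (abs_nonneg _)
      _ = |Q b x'| * (C * Real.exp (δ * R') * Real.exp (-(δ * σ x b))) := by ring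
  rw [Matrix.mul_apply]
  calc |∑ x', G x x' * Qᵀ x' b| = |∑ x', G x x' * Q b x'| := by rfl
    _ ≤ ∑ x', |G x x' * Q b x'| := Finset.abs_sum_le_sum_abs _ _
    _ ≤ ∑ x', |Q b x'| * (C * Real.exp (δ * R') * Real.exp (-(δ * σ x b))) := Finset.sum_le_sum fun x' _ => hpt x'
    _ = (∑ x', |Q b x'|) * (C * Real.exp (δ * R') * Real.exp (-(δ * σ x b))) := by rw [Finset.sum_mul]
    _ ≤ q₁ * (C * Real.exp (δ * R') * Real.exp (-(δ * σ x b))) := mul_le_mul_of_nonneg_right (hq b) (by positivity)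
    _ = q₁ * C * Real.exp (δ * R') * Real.exp (-(δ * σ x b)) := by ring

/-! ## §3 The two rate letters of PARTs 107 ∕ 112 from the one soft letter -/

omit [Fintype c] [DecidableEq c] in
/-- **`abs_blockProp_sub_le_of_soft` — THE BLOCK PROPAGATOR'S ONE-STEP INCREMENT FROM THE SOFT RESOLVENT'S** [our proof; §1 + §2]: for ANY square `K` on `ν`, `K′` on `ν′`,
`|(Qf·K′⁻¹·Qfᵀ − K⁻¹)(x,y)| ≤ εe^{−δD(x,y)}` (`ε, δ ≥ 0`) and the block locality of `Q` ⟹ `|(P_K(Q) − P_{K′}(Q·Qf))(b,b′)| ≤ q₁²·ε·e^{δR}·e^{−δρ(b,b′)}` — PART 107's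
`hdiff` letter with `ε₂ = q₁²εe^{δR}`. -/
theorem abs_blockProp_sub_le_of_soft {K : Matrix ν ν ℝ} {K' : Matrix ν' ν' ℝ} {Qf : Matrix ν ν' ℝ} {ε δ q₁ R : ℝ} (hε : 0 ≤ ε) (hδ : 0 ≤ δ)
    (hE : ∀ x y, |(Qf * K'⁻¹ * Qfᵀ - K⁻¹) x y| ≤ ε * Real.exp (-(δ * D x y))) (hq : ∀ b, ∑ x, |Q b x| ≤ q₁)
    (hQρ : ∀ b x b' x', Q b x ≠ 0 → Q b' x' ≠ 0 → ρ b b' ≤ D x x' + R) (b b' : c) :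
    |(blockProp K Q - blockProp K' (Q * Qf)) b b'| ≤ q₁ ^ 2 * ε * Real.exp (δ * R) * Real.exp (-(δ * ρ b b')) := by
  rw [blockProp_sub_blockProp_mul]
  have hE' : ∀ x y, |(K⁻¹ - Qf * K'⁻¹ * Qfᵀ) x y| ≤ ε * Real.exp (-(δ * D x y)) := fun x y => by
    rw [← neg_sub, Matrix.neg_apply, abs_neg]; exact hE x y
  exact abs_conj_transpose_apply_le hε hδ hE' hq hQρ b b'

omit [Fintype c] [DecidableEq c] in
/-- **`abs_avg_col_sub_le_of_soft` — THE SOFT COLUMNS' AVERAGED ONE-STEP MISMATCH FROM THE SOFT RESOLVENT'S** [our proof; §1 + §2]: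
`|(Qf·K′⁻¹·Qfᵀ − K⁻¹)(x,y)| ≤ εe^{−δD(x,y)}` and the fine-to-unit locality of `Q` ⟹ `|(Qf·(K′⁻¹·(Q·Qf)ᵀ) − K⁻¹·Qᵀ)(x,b)| ≤ q₁·ε·e^{δR′}·e^{−δσ(x,b)}` — PART 112's `hmis`
letter with `ε₁ = q₁εe^{δR′}`. -/
theorem abs_avg_col_sub_le_of_soft {K : Matrix ν ν ℝ} {K' : Matrix ν' ν' ℝ} {Qf : Matrix ν ν' ℝ} {ε δ q₁ R' : ℝ} (hε : 0 ≤ ε) (hδ : 0 ≤ δ)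
    (hE : ∀ x y, |(Qf * K'⁻¹ * Qfᵀ - K⁻¹) x y| ≤ ε * Real.exp (-(δ * D x y))) (hq : ∀ b, ∑ x, |Q b x| ≤ q₁)
    (hQσ : ∀ b x x', Q b x' ≠ 0 → σ x b ≤ D x x' + R') (x : ν) (b : c) :
    |(Qf * (K'⁻¹ * (Q * Qf)ᵀ) - K⁻¹ * Qᵀ) x b| ≤ q₁ * ε * Real.exp (δ * R') * Real.exp (-(δ * σ x b)) := by
  rw [avg_mul_col_sub_eq]
  exact abs_mul_transpose_apply_le hε hδ hE hq hQσ x b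

end Transfer

/-! ## §4 Σ's and Ξ's RATE from the one soft letter -/

section End

variable {H : Matrix ν ν ℝ} {Q : Matrix c ν ℝ} {H' : Matrix ν' ν' ℝ} {Qf : Matrix ν ν' ℝ} {a : ℝ}
variable {ρ : c → c → ℝ} {Kf : ℝ → ℝ} {σ : ν → c → ℝ} {D : ν → ν → ℝ}

/-- **`abs_effForm_sub_le_of_soft` — Σ's RATE FROM THE SOFT RESOLVENT'S ONE-STEP LAW** [our proof; §3 + PART 107 `abs_effForm_sub_effForm_le` BY NAME]: two constrained data
`(H, Q)` on `ν` and `(H′, Q·Qf)` on `ν′` under PART 105's hypotheses at both levels (symmetric PSD forms, `a > 0`, `K = H + Qᵀ(a•1)Q` and `K′ = H′ + (QQf)ᵀ(a•1)(QQf)`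
coercive, upper bound `Λ`, unit decay of both block propagators at `(c₀, δ₀)`), the ONE soft letter `|(Qf·K′⁻¹·Qfᵀ − K⁻¹)(x,y)| ≤ εe^{−δD(x,y)}` at a fine rate `δ ≥ δ₀` and
the block locality of `Q` (`Σ_x|Q(b,x)| ≤ q₁`, `Q(b,x) ≠ 0 → Q(b′,x′) ≠ 0 → ρ(b,b′) ≤ D(x,x′) + R`) ⟹
`|(𝒮 − 𝒮′)(b,b′)| ≤ 4(Λ+a)²·(q₁²εe^{δR})·Kf(t∕2)²·e^{−(t∕2)ρ(b,b′)}`, `t = rate Kf (Λ+a)⁻¹ c₀ δ₀` — LINEAR in `ε`. -/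
theorem abs_effForm_sub_le_of_soft (hKf : ∀ r, 0 < r → 0 ≤ Kf r) (hρ : IsPseudoDist ρ) (hS : SumBound ρ Kf) (ha : 0 < a)
    {γ Λ c₀ δ₀ ε δ q₁ R : ℝ} (hγ : 0 < γ) (hΛ : 0 ≤ Λ) (hc₀ : 0 ≤ c₀) (hδ₀ : 0 < δ₀) (hε : 0 ≤ ε) (hδ : δ₀ ≤ δ)
    (hH : Hᵀ = H) (hpsd : ∀ z : ν → ℝ, 0 ≤ z ⬝ᵥ (H *ᵥ z)) (hK : QGQInverse.Coercive (H + Qᵀ * (a • (1 : Matrix c c ℝ)) * Q) γ)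
    (hUB : ∀ B : c → ℝ, ∃ u : ν → ℝ, Q *ᵥ u = B ∧ u ⬝ᵥ (H *ᵥ u) ≤ Λ * (B ⬝ᵥ B))
    (hP : ∀ b b', |blockProp (H + Qᵀ * (a • (1 : Matrix c c ℝ)) * Q) Q b b'| ≤ c₀ * Real.exp (-(δ₀ * ρ b b')))
    (hH' : H'ᵀ = H') (hpsd' : ∀ z : ν' → ℝ, 0 ≤ z ⬝ᵥ (H' *ᵥ z))
    (hK' : QGQInverse.Coercive (H' + (Q * Qf)ᵀ * (a • (1 : Matrix c c ℝ)) * (Q * Qf)) γ)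
    (hUB' : ∀ B : c → ℝ, ∃ u : ν' → ℝ, (Q * Qf) *ᵥ u = B ∧ u ⬝ᵥ (H' *ᵥ u) ≤ Λ * (B ⬝ᵥ B))
    (hP' : ∀ b b', |blockProp (H' + (Q * Qf)ᵀ * (a • (1 : Matrix c c ℝ)) * (Q * Qf)) (Q * Qf) b b'| ≤ c₀ * Real.exp (-(δ₀ * ρ b b')))
    (hE : ∀ x y, |(Qf * (H' + (Q * Qf)ᵀ * (a • (1 : Matrix c c ℝ)) * (Q * Qf))⁻¹ * Qfᵀ - (H + Qᵀ * (a • (1 : Matrix c c ℝ)) * Q)⁻¹) x y| ≤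
      ε * Real.exp (-(δ * D x y)))
    (hq : ∀ b, ∑ x, |Q b x| ≤ q₁) (hQρ : ∀ b x b' x', Q b x ≠ 0 → Q b' x' ≠ 0 → ρ b b' ≤ D x x' + R) (b b' : c) :
    |(effForm H Q - effForm H' (Q * Qf)) b b'| ≤
      4 * (Λ + a) ^ 2 * (q₁ ^ 2 * ε * Real.exp (δ * R)) * Kf (rate Kf (Λ + a)⁻¹ c₀ δ₀ / 2) ^ 2 *
        Real.exp (-(rate Kf (Λ + a)⁻¹ c₀ δ₀ / 2 * ρ b b')) := by
  have hδ' : 0 ≤ δ := hδ₀.le.trans hδ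
  -- the `hdiff` letter of PART 107 at rate `δ₀ ≤ δ`, from the one soft letter
  have hdiff : ∀ b b', |(blockProp (H + Qᵀ * (a • (1 : Matrix c c ℝ)) * Q) Q -
      blockProp (H' + (Q * Qf)ᵀ * (a • (1 : Matrix c c ℝ)) * (Q * Qf)) (Q * Qf)) b b'| ≤
      q₁ ^ 2 * ε * Real.exp (δ * R) * Real.exp (-(δ₀ * ρ b b')) := fun b b' =>
    (abs_blockProp_sub_le_of_soft hε hδ' hE hq hQρ b b').trans
      (mul_le_mul_of_nonneg_left (Real.exp_le_exp.mpr (by nlinarith [hρ.nonneg b b'])) (by positivity))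
  exact abs_effForm_sub_effForm_le hKf hρ hS ha hγ hΛ hc₀ hδ₀ (by positivity) hH hpsd hK hUB hP hH' hpsd' hK' hUB' hP' hdiff b b'

/-- **`abs_avg_minOp_sub_le_of_soft` — Ξ's RATE FROM THE SOFT RESOLVENT'S ONE-STEP LAW** [our proof; §3 + PART 112 `abs_avg_minOp_sub_le` BY NAME]: under the hypotheses of
`abs_effForm_sub_le_of_soft`, the fine-to-unit gauge `σ ≥ 0` compatible with `ρ`, the soft-column decay `|(K⁻¹Qᵀ)(x,b)| ≤ c₁e^{−δ₁σ(x,b)}` at a rate `δ₁ ≤ δ`, and the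
fine-to-unit locality `Q(b,x′) ≠ 0 → σ(x,b) ≤ D(x,x′) + R′`:
`|(Qf·ℋ′ − ℋ)(x,b)| ≤ (2(Λ+a)·q₁εe^{δR′} + 4(Λ+a)²Kf(t∕2)²·c₁·q₁²εe^{δR})·Kf(m∕2)·e^{−(m∕2)σ(x,b)}`, `t = rate Kf (Λ+a)⁻¹ c₀ δ₀`, `m = min δ₁ (t∕2)` — LINEAR in `ε`:
the Ξ-block's RATE clause costs the ONE soft letter, PART 105's decay letters and the upper bound, nothing of the hard minimiser's own one-step analysis. -/
theorem abs_avg_minOp_sub_le_of_soft (hKf : ∀ r, 0 < r → 0 ≤ Kf r) (hρ : IsPseudoDist ρ) (hS : SumBound ρ Kf) (ha : 0 < a)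
    {γ Λ c₀ δ₀ ε δ q₁ R R' c₁ δ₁ : ℝ} (hγ : 0 < γ) (hΛ : 0 ≤ Λ) (hc₀ : 0 ≤ c₀) (hδ₀ : 0 < δ₀) (hε : 0 ≤ ε) (hδ : δ₀ ≤ δ)
    (hc₁ : 0 ≤ c₁) (hδ₁ : 0 < δ₁) (hδ₁δ : δ₁ ≤ δ)
    (hH : Hᵀ = H) (hpsd : ∀ z : ν → ℝ, 0 ≤ z ⬝ᵥ (H *ᵥ z)) (hK : QGQInverse.Coercive (H + Qᵀ * (a • (1 : Matrix c c ℝ)) * Q) γ)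
    (hUB : ∀ B : c → ℝ, ∃ u : ν → ℝ, Q *ᵥ u = B ∧ u ⬝ᵥ (H *ᵥ u) ≤ Λ * (B ⬝ᵥ B))
    (hP : ∀ b b', |blockProp (H + Qᵀ * (a • (1 : Matrix c c ℝ)) * Q) Q b b'| ≤ c₀ * Real.exp (-(δ₀ * ρ b b')))
    (hH' : H'ᵀ = H') (hpsd' : ∀ z : ν' → ℝ, 0 ≤ z ⬝ᵥ (H' *ᵥ z))
    (hK' : QGQInverse.Coercive (H' + (Q * Qf)ᵀ * (a • (1 : Matrix c c ℝ)) * (Q * Qf)) γ)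
    (hUB' : ∀ B : c → ℝ, ∃ u : ν' → ℝ, (Q * Qf) *ᵥ u = B ∧ u ⬝ᵥ (H' *ᵥ u) ≤ Λ * (B ⬝ᵥ B))
    (hP' : ∀ b b', |blockProp (H' + (Q * Qf)ᵀ * (a • (1 : Matrix c c ℝ)) * (Q * Qf)) (Q * Qf) b b'| ≤ c₀ * Real.exp (-(δ₀ * ρ b b')))
    (hE : ∀ x y, |(Qf * (H' + (Q * Qf)ᵀ * (a • (1 : Matrix c c ℝ)) * (Q * Qf))⁻¹ * Qfᵀ - (H + Qᵀ * (a • (1 : Matrix c c ℝ)) * Q)⁻¹) x y| ≤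
      ε * Real.exp (-(δ * D x y)))
    (hq : ∀ b, ∑ x, |Q b x| ≤ q₁) (hQρ : ∀ b x b' x', Q b x ≠ 0 → Q b' x' ≠ 0 → ρ b b' ≤ D x x' + R)
    (hQσ : ∀ b x x', Q b x' ≠ 0 → σ x b ≤ D x x' + R')
    (hσ0 : ∀ x b, 0 ≤ σ x b) (hσρ : ∀ x b b', σ x b ≤ σ x b' + ρ b' b)
    (hT : ∀ x b, |((H + Qᵀ * (a • (1 : Matrix c c ℝ)) * Q)⁻¹ * Qᵀ) x b| ≤ c₁ * Real.exp (-(δ₁ * σ x b))) (x : ν) (b : c) :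
    |(Qf * minOp H' (Q * Qf) - minOp H Q) x b| ≤
      (2 * (Λ + a) * (q₁ * ε * Real.exp (δ * R')) +
          4 * (Λ + a) ^ 2 * Kf (rate Kf (Λ + a)⁻¹ c₀ δ₀ / 2) ^ 2 * c₁ * (q₁ ^ 2 * ε * Real.exp (δ * R))) *
        Kf (min δ₁ (rate Kf (Λ + a)⁻¹ c₀ δ₀ / 2) / 2) * Real.exp (-(min δ₁ (rate Kf (Λ + a)⁻¹ c₀ δ₀ / 2) / 2 * σ x b)) := by
  have hδ' : 0 ≤ δ := hδ₀.le.trans hδ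
  have hq0 : 0 ≤ q₁ := (Finset.sum_nonneg fun y _ => abs_nonneg (Q b y)).trans (hq b)
  have hdiff : ∀ b b', |(blockProp (H + Qᵀ * (a • (1 : Matrix c c ℝ)) * Q) Q -
      blockProp (H' + (Q * Qf)ᵀ * (a • (1 : Matrix c c ℝ)) * (Q * Qf)) (Q * Qf)) b b'| ≤
      q₁ ^ 2 * ε * Real.exp (δ * R) * Real.exp (-(δ₀ * ρ b b')) := fun b b' =>
    (abs_blockProp_sub_le_of_soft hε hδ' hE hq hQρ b b').trans
      (mul_le_mul_of_nonneg_left (Real.exp_le_exp.mpr (by nlinarith [hρ.nonneg b b'])) (by positivity))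
  have hmis : ∀ x b, |(Qf * ((H' + (Q * Qf)ᵀ * (a • (1 : Matrix c c ℝ)) * (Q * Qf))⁻¹ * (Q * Qf)ᵀ) -
      (H + Qᵀ * (a • (1 : Matrix c c ℝ)) * Q)⁻¹ * Qᵀ) x b| ≤ q₁ * ε * Real.exp (δ * R') * Real.exp (-(δ₁ * σ x b)) := fun x b =>
    (abs_avg_col_sub_le_of_soft hε hδ' hE hq hQσ x b).trans
      (mul_le_mul_of_nonneg_left (Real.exp_le_exp.mpr (by nlinarith [hσ0 x b])) (by positivity))
  exact abs_avg_minOp_sub_le hKf hρ hS Qf ha hγ hΛ hc₀ hδ₀ (by positivity) (by positivity) hc₁ hδ₁ hH hpsd hK hUB hP hH' hpsd' hK' hUB' hP'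
    hdiff hσ0 hσρ hT hmis x b

end End

end Summit.QuantumFields.BalabanUV.Beta.GAN24.BlockRatesFromSoftResolvent

end
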